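import Summits.ValiantsHypothesis.ValiantsHypothesis.Theorems.LacunarySymmetroidMatrixDescartesCensusTwistedRolle
import Summits.ValiantsHypothesis.ValiantsHypothesis.Theorems.LacunarySymmetroidMatrixDescartesCensusSupportDescartes

/-!
# `MatrixDescartes` census — C25, the NEWTON CONE of a Descartes-sharp fewnomial (kernel version)

HONEST FRAMING.  Object-search cell `pub-symmetroid`, route crux `Theses.LacunarySymmetroid.MatrixDescartes`
(ledger item stmt-ValiantsHypothesis-18050).  This file puts the cell's structural statement C25 («Newton cone»,
STRUCTURE.md §1.1; engine-3 g3 `NEWTON-CONE.md`, hand re-derivation signed by referee g18 `NEWTON-CONE-SIGN-g18.md`)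
into the kernel, in the case the census uses (natural exponents, distinct positive roots):

* `newton_cone` — if a real fewnomial `f = ∑_{t<n} cₜ X^{eₜ}` (`e` strictly increasing) has at least `n − 1`
  distinct positive roots (Descartes-sharp), then with `Aₜ := |cₜ| · ∏_{u≠t} |eₜ − e_u|` every triple `p < q < r`
  satisfies `A_p^{e_r−e_q} · A_r^{e_q−e_p} ≤ A_q^{e_r−e_p}`; `newton_cone_log` is the concavity form
  `(e_r − e_q) log A_p + (e_q − e_p) log A_r ≤ (e_r − e_p) log A_q`.
* `newton_cone_coeff` — the same for an arbitrary real polynomial indexed by its own support (`#supp f − 1`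
  distinct positive roots), and `newton_cone_det_pencil` / `support_det_pencil_eq_sumset_of_sharp` — the census
  reading: a pencil `det (∑ X^{d l} • S l)` with `#(m-fold sumset of d) − 1` positive roots has full support and its
  coefficients lie in the cone.
* the two ingredients live in the companion file `…CensusTwistedRolle.lean`: the TWISTED ROLLE inequality
  `#Z₊(f) ≤ #Z₊(X·f′ − E·f) + 1` (iterated over the killed exponents: `card_posRoots_le_card_posRoots_twists`) and
  the TRINOMIAL LEMMA `trinomial_two_posRoots_le` (`(a+b)^{a+b}|A|^b|C|^a ≤ |B|^{a+b} a^a b^b` from two positive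
  roots of `A Xⁱ + B X^{i+a} + C X^{i+a+b}`).

Why the cell wants it (DATA-CUT item (b), K1): the Descartes-extremal chamber of a support lies in this explicit
cone in `log|c|`-space — a MAGNITUDE-level necessary condition for `ζ(2,6;d) = 20` on a Sidon support / `(3,4;d) = 19`
on a 20-monomial support, and the row family «N» of the cell's exact LP certificates (T-NC-LP-CERT, LP34).  What is NOT
here: real (non-integer) exponents and roots counted with multiplicity (the signed paper statement is that general);
the equality case; the letter/branch («layer B») analysis and the LP certificates themselves; anything about the crux
`MatrixDescartes` or `VP ≠ VNP`.

[folklore] Elementary: Rolle's theorem for `u ↦ f(u)·u^{−E}`, Descartes-type counting, weighted AM–GM.  The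
statement is classical in spirit (Newton's inequalities / the trinomial root condition); no single source.
-/

-- `Summit.ValiantsHypothesis.ValiantsHypothesis.…` repeats a component by the D-0017 layout
-- (single-conjunct summit), which the `dupNamespace` linter flags; the name is mandated.
set_option linter.dupNamespace false

namespace Summit.ValiantsHypothesis.ValiantsHypothesis.Theorems.LacunarySymmetroidMatrixDescartes.Census

open Polynomial Finset
open scoped BigOperators Polynomial

/-- Peeling two factors off a product over `univ.erase t`. [folklore] -/
theorem prod_univ_erase_eq_mul_mul_prod {n : ℕ} (g : Fin n → ℝ) {t x y : Fin n} (hx : x ≠ t)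
    (hy : y ≠ t) (hxy : x ≠ y) :
    ∏ u ∈ univ.erase t, g u = g x * g y * ∏ u ∈ ((univ.erase t).erase x).erase y, g u := by
  have hx' : x ∈ univ.erase t := by simp [hx]
  have hy' : y ∈ (univ.erase t).erase x := by simp [hy, hxy.symm]
  rw [← Finset.mul_prod_erase _ _ hx', ← Finset.mul_prod_erase _ _ hy', mul_assoc]

/-- **C25 — the NEWTON CONE of a Descartes-sharp fewnomial (product form).**  Let
`f = ∑_{t<n} cₜ X^{eₜ}` be a real fewnomial with strictly increasing natural exponents `e₀ < ⋯ < e_{n−1}` and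
suppose `f` has at least `n − 1` distinct positive roots (the maximum Descartes' rule allows).  Put
`Aₜ := |cₜ| · ∏_{u ≠ t} |eₜ − e_u|`.  Then for every triple `p < q < r`:
`A_p^{e_r − e_q} · A_r^{e_q − e_p} ≤ A_q^{e_r − e_p}`,
i.e. the points `(eₜ, log Aₜ)` are in concave position (the cell's «Newton cone» `NC(e)` in `log|c|`-space; at an
equally spaced triple with `n = 3` it is Newton's inequality / the trinomial root condition).  Proof: kill the `n − 3`
exponents outside `{p,q,r}` by Euler twists (`card_posRoots_le_card_posRoots_twists`: each twist multiplies `cₜ` by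
`eₜ − e_u` and loses at most one positive root), leaving a trinomial with two positive roots, and apply
`trinomial_two_posRoots_le`; the gap factors `|eₜ − e_u|`, `u ∈ {p,q,r}`, are exactly what makes all constants cancel.
Source: the cell's STRUCTURE.md C25 (engine-3 g3 NEWTON-CONE.md; hand re-derivation signed by referee g18,
NEWTON-CONE-SIGN-g18.md); stated there for real exponents and roots with multiplicity — typed here for natural
exponents and distinct roots, the case the census uses. [folklore] -/
theorem newton_cone {n : ℕ} (e : Fin n → ℕ) (he : StrictMono e) (c : Fin n → ℝ)
    (hZ : n ≤ ((∑ t, C (c t) * X ^ (e t)).roots.toFinset.filter (fun x => 0 < x)).card + 1)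
    {p q r : Fin n} (hpq : p < q) (hqr : q < r) :
    (|c p| * ∏ u ∈ univ.erase p, |(e p : ℝ) - e u|) ^ (e r - e q) *
        (|c r| * ∏ u ∈ univ.erase r, |(e r : ℝ) - e u|) ^ (e q - e p)
      ≤ (|c q| * ∏ u ∈ univ.erase q, |(e q : ℝ) - e u|) ^ (e r - e p) := by
  have hpr : p < r := hpq.trans hqr
  have hpq' : p ≠ q := hpq.ne
  have hqr' : q ≠ r := hqr.ne
  have hpr' : p ≠ r := hpr.ne
  have hepq : e p < e q := he hpq
  have heqr : e q < e r := he hqr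
  -- exponent gaps `a = e q − e p`, `b = e r − e q`
  obtain ⟨a, ha⟩ : ∃ a, e q = e p + a := ⟨e q - e p, by omega⟩
  obtain ⟨b, hb⟩ : ∃ b, e r = e q + b := ⟨e r - e q, by omega⟩
  have ha0 : 0 < a := by omega
  have hb0 : 0 < b := by omega
  rw [show e r - e q = b by omega, show e q - e p = a by omega, show e r - e p = a + b by omega]
  -- the killed index set `U = univ ∖ {p, q, r}`
  set U : Finset (Fin n) := ((univ.erase p).erase q).erase r with hU
  have hmemU : ∀ t, t ∈ U ↔ (t ≠ p ∧ t ≠ q ∧ t ≠ r) := by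
    intro t; simp only [hU, Finset.mem_erase, Finset.mem_univ, and_true]; tauto
  have hcardU : U.card + 3 = n := by
    have h3 : 3 ≤ n := by have := r.isLt; have := Fin.lt_def.mp hpq; have := Fin.lt_def.mp hqr; omega
    have m1 : p ∈ (univ : Finset (Fin n)) := Finset.mem_univ _
    have m2 : q ∈ univ.erase p := by simp [hpq'.symm]
    have m3 : r ∈ (univ.erase p).erase q := by simp [hqr'.symm, hpr'.symm]
    rw [hU, Finset.card_erase_of_mem m3, Finset.card_erase_of_mem m2, Finset.card_erase_of_mem m1,
      Finset.card_univ, Fintype.card_fin]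
    omega
  -- iterated twisted Rolle: at most `#U = n − 3` positive roots are lost
  have h1 := card_posRoots_le_card_posRoots_twists e c U
  -- the twisted fewnomial is the trinomial on `{p, q, r}`
  have hzero : ∀ t ∈ U, c t * ∏ u ∈ U, ((e t : ℝ) - e u) = 0 := fun t ht => by
    rw [Finset.prod_eq_zero ht (sub_self _), mul_zero]
  have htri : (∑ t, C (c t * ∏ u ∈ U, ((e t : ℝ) - e u)) * X ^ (e t))
      = C (c p * ∏ u ∈ U, ((e p : ℝ) - e u)) * X ^ (e p)
        + C (c q * ∏ u ∈ U, ((e q : ℝ) - e u)) * X ^ (e q)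
        + C (c r * ∏ u ∈ U, ((e r : ℝ) - e u)) * X ^ (e r) := by
    rw [← Finset.sum_subset (Finset.subset_univ ({p, q, r} : Finset (Fin n)))]
    · rw [Finset.sum_insert (by simp [hpq', hpr']), Finset.sum_insert (by simp [hqr']),
        Finset.sum_singleton]
      ring
    · intro t _ ht
      have htU : t ∈ U := (hmemU t).mpr (by simpa [not_or] using ht)
      rw [hzero t htU, map_zero, zero_mul]
  have h2 : 1 < ((C (c p * ∏ u ∈ U, ((e p : ℝ) - e u)) * X ^ (e p)
        + C (c q * ∏ u ∈ U, ((e q : ℝ) - e u)) * X ^ (e p + a)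
        + C (c r * ∏ u ∈ U, ((e r : ℝ) - e u)) * X ^ (e p + a + b)).roots.toFinset.filter
          (fun x => 0 < x)).card := by
    rw [← ha, ← hb, ← htri]
    omega
  have tri := trinomial_two_posRoots_le ha0 hb0 _ _ _ h2
  -- the full gap products: peel off the two factors inside `{p, q, r}`
  have gqp : |(e q : ℝ) - e p| = a := by
    rw [ha]; push_cast; rw [add_sub_cancel_left, Nat.abs_cast]
  have grq : |(e r : ℝ) - e q| = b := by
    rw [hb]; push_cast; rw [add_sub_cancel_left, Nat.abs_cast]
  have grp : |(e r : ℝ) - e p| = a + b := by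
    rw [hb, ha]; push_cast; rw [add_assoc, add_sub_cancel_left]
    exact abs_of_nonneg (by positivity)
  have gpq : |(e p : ℝ) - e q| = a := by rw [abs_sub_comm]; exact gqp
  have gqr : |(e q : ℝ) - e r| = b := by rw [abs_sub_comm]; exact grq
  have gpr : |(e p : ℝ) - e r| = a + b := by rw [abs_sub_comm]; exact grp
  have hWabs : ∀ t, ∏ u ∈ U, |(e t : ℝ) - e u| = |∏ u ∈ U, ((e t : ℝ) - e u)| := fun t =>
    (Finset.abs_prod _ _).symm
  have hUq : ((univ.erase q).erase p).erase r = U := by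
    ext t; simp only [hmemU, Finset.mem_erase, Finset.mem_univ, and_true]; tauto
  have hUr : ((univ.erase r).erase p).erase q = U := by
    ext t; simp only [hmemU, Finset.mem_erase, Finset.mem_univ, and_true]; tauto
  have prodp : ∏ u ∈ univ.erase p, |(e p : ℝ) - e u| = (a : ℝ) * ((a : ℝ) + b) * |∏ u ∈ U, ((e p : ℝ) - e u)| := by
    rw [prod_univ_erase_eq_mul_mul_prod _ hpq'.symm hpr'.symm hqr', gpq, gpr, hWabs]
  have prodq : ∏ u ∈ univ.erase q, |(e q : ℝ) - e u| = (a : ℝ) * (b : ℝ) * |∏ u ∈ U, ((e q : ℝ) - e u)| := by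
    rw [prod_univ_erase_eq_mul_mul_prod _ hpq' hqr'.symm hpr', gqp, gqr, hUq, hWabs]
  have prodr : ∏ u ∈ univ.erase r, |(e r : ℝ) - e u| = ((a : ℝ) + b) * (b : ℝ) * |∏ u ∈ U, ((e r : ℝ) - e u)| := by
    rw [prod_univ_erase_eq_mul_mul_prod _ hpr' hqr' hpq', grp, grq, hUr, hWabs]
  rw [prodp, prodq, prodr]
  have hfac : (0 : ℝ) ≤ (a : ℝ) ^ b * (b : ℝ) ^ a := by positivity
  generalize hs : ((a : ℝ) + b) = s at tri ⊢
  calc (|c p| * ((a : ℝ) * s * |∏ u ∈ U, ((e p : ℝ) - e u)|)) ^ b *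
        (|c r| * (s * (b : ℝ) * |∏ u ∈ U, ((e r : ℝ) - e u)|)) ^ a
      = (s ^ (a + b) * |c p * ∏ u ∈ U, ((e p : ℝ) - e u)| ^ b *
          |c r * ∏ u ∈ U, ((e r : ℝ) - e u)| ^ a) * ((a : ℝ) ^ b * (b : ℝ) ^ a) := by
        rw [abs_mul, abs_mul]; ring
    _ ≤ (|c q * ∏ u ∈ U, ((e q : ℝ) - e u)| ^ (a + b) * (a : ℝ) ^ a * (b : ℝ) ^ b) *
          ((a : ℝ) ^ b * (b : ℝ) ^ a) := mul_le_mul_of_nonneg_right tri hfac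
    _ = (|c q| * ((a : ℝ) * (b : ℝ) * |∏ u ∈ U, ((e q : ℝ) - e u)|)) ^ (a + b) := by
        rw [abs_mul]; ring

/-- **C25, logarithmic (concavity) form.**  Under the hypotheses of `newton_cone` and with all coefficients
non-zero, the numbers `aₜ := log (|cₜ| · ∏_{u≠t} |eₜ − e_u|)` satisfy, for every `p < q < r`,
`(e_r − e_q) · a_p + (e_q − e_p) · a_r ≤ (e_r − e_p) · a_q` — the points `(eₜ, aₜ)` are in concave position.
[folklore] -/
theorem newton_cone_log {n : ℕ} (e : Fin n → ℕ) (he : StrictMono e) (c : Fin n → ℝ) (hc : ∀ t, c t ≠ 0)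
    (hZ : n ≤ ((∑ t, C (c t) * X ^ (e t)).roots.toFinset.filter (fun x => 0 < x)).card + 1)
    {p q r : Fin n} (hpq : p < q) (hqr : q < r) :
    ((e r : ℝ) - e q) * Real.log (|c p| * ∏ u ∈ univ.erase p, |(e p : ℝ) - e u|) +
        ((e q : ℝ) - e p) * Real.log (|c r| * ∏ u ∈ univ.erase r, |(e r : ℝ) - e u|)
      ≤ ((e r : ℝ) - e p) * Real.log (|c q| * ∏ u ∈ univ.erase q, |(e q : ℝ) - e u|) := by
  have h := newton_cone e he c hZ hpq hqr
  have hpos : ∀ t, 0 < |c t| * ∏ u ∈ univ.erase t, |(e t : ℝ) - e u| := by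
    intro t
    refine mul_pos (abs_pos.mpr (hc t)) (Finset.prod_pos fun u hu => abs_pos.mpr (sub_ne_zero.mpr ?_))
    exact_mod_cast fun h => (Finset.mem_erase.mp hu).1 (he.injective h).symm
  have hlog := Real.log_le_log (by have := hpos p; have := hpos r; positivity) h
  rw [Real.log_mul (pow_ne_zero _ (hpos p).ne') (pow_ne_zero _ (hpos r).ne'), Real.log_pow, Real.log_pow,
    Real.log_pow] at hlog
  have hepq : e p ≤ e q := (he hpq).le
  have heqr : e q ≤ e r := (he hqr).le
  have hepr : e p ≤ e r := hepq.trans heqr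
  push_cast [Nat.cast_sub hepq, Nat.cast_sub heqr, Nat.cast_sub hepr] at hlog
  linarith


/-- **C25 in coefficient/support form** — the version that applies verbatim to `det` of a census pencil.  If a
real polynomial `f` has at least `#supp f − 1` distinct positive roots (Descartes-sharp on its own support), then
for all exponents `p < q < r` in its support, with `A_s := |coeff f s| · ∏_{u ∈ supp f, u ≠ s} |s − u|`,
`A_p^{r−q} · A_r^{q−p} ≤ A_q^{r−p}`.  (E.g. a `2 × 2` pencil on a Sidon support `d` with `Z₊ = C(K+1,2) − 1 = D(2,K)`:
the `C(K+1,2)` coefficients `det S_i` (at `2d_i`) and `2·D(S_i,S_j)` (at `d_i + d_j`) lie in the cone.) [folklore] -/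
theorem newton_cone_coeff (f : ℝ[X])
    (hZ : f.support.card ≤ (f.roots.toFinset.filter (fun x => 0 < x)).card + 1)
    {p q r : ℕ} (hp : p ∈ f.support) (hq : q ∈ f.support) (hr : r ∈ f.support)
    (hpq : p < q) (hqr : q < r) :
    (|f.coeff p| * ∏ u ∈ f.support.erase p, |(p : ℝ) - u|) ^ (r - q) *
        (|f.coeff r| * ∏ u ∈ f.support.erase r, |(r : ℝ) - u|) ^ (q - p)
      ≤ (|f.coeff q| * ∏ u ∈ f.support.erase q, |(q : ℝ) - u|) ^ (r - p) := by
  classical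
  set n := f.support.card with hn
  set e : Fin n ↪o ℕ := f.support.orderEmbOfFin hn.symm with he_def
  have he : StrictMono e := e.strictMono
  have hinj : Function.Injective e := e.injective
  have himage : Finset.univ.image e = f.support := Finset.image_orderEmbOfFin_univ _ _
  have hidx : ∀ {s : ℕ}, s ∈ f.support → ∃ t, e t = s := by
    intro s hs
    have : s ∈ Set.range e := by
      rw [he_def, Finset.range_orderEmbOfFin]; exact_mod_cast hs
    exact this
  obtain ⟨tp, htp⟩ := hidx hp
  obtain ⟨tq, htq⟩ := hidx hq
  obtain ⟨tr, htr⟩ := hidx hr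
  -- `f` as a fewnomial indexed by `Fin n`
  have hf : (∑ t, C (f.coeff (e t)) * X ^ (e t)) = f := by
    have h1 : ∑ u ∈ Finset.univ.image e, C (f.coeff u) * X ^ u = ∑ t, C (f.coeff (e t)) * X ^ (e t) :=
      Finset.sum_image hinj.injOn
    rw [← h1, himage]
    exact f.as_sum_support_C_mul_X_pow.symm
  have hZ' : n ≤ ((∑ t, C (f.coeff (e t)) * X ^ (e t)).roots.toFinset.filter
      (fun x => 0 < x)).card + 1 := by
    rw [hf]; exact hZ
  have key := newton_cone e he (fun t => f.coeff (e t)) hZ' (p := tp) (q := tq) (r := tr)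
    (he.lt_iff_lt.mp (by rw [htp, htq]; exact hpq)) (he.lt_iff_lt.mp (by rw [htq, htr]; exact hqr))
  have hprod : ∀ (t : Fin n) (z : ℝ), ∏ u ∈ univ.erase t, |z - ((e u : ℕ) : ℝ)|
      = ∏ u ∈ f.support.erase (e t), |z - (u : ℝ)| := by
    intro t z
    rw [← himage, ← Finset.image_erase hinj, Finset.prod_image hinj.injOn]
  rw [hprod tp, hprod tq, hprod tr, htp, htq, htr] at key
  exact key


/-- **C25 for census pencils.**  If the determinant of a lacunary pencil `F = ∑ l, X^{d l} • S l` (ANY real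
`m × m` matrices `S l`) has at least `#(m-fold sumset of d) − 1` distinct positive roots — Descartes-sharp AT SUPPORT
RESOLUTION, e.g. `Z₊ = 20 = D(2,6)` on a Sidon `(2,6)` support or `Z₊ = 19 = D(3,4)` on a 20-monomial `(3,4)` support —
then every triple `p < q < r` of exponents in the support of `det F` satisfies the Newton-cone inequality
`A_p^{r−q} · A_r^{q−p} ≤ A_q^{r−p}`, `A_s = |coeff (det F) s| · ∏_{u ∈ supp, u ≠ s} |s − u|`.  (The support is then
the whole sumset: `support_det_pencil_eq_sumset_of_sharp`.)  This is the row family «N»/«C25» of the cell's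
support-level LP certificates, as a kernel theorem about the pencil. [folklore] -/
theorem newton_cone_det_pencil {K m : ℕ} (d : Fin K → ℕ) (S : Fin K → Matrix (Fin m) (Fin m) ℝ)
    (hZ : ((Finset.univ : Finset (Fin m → Fin K)).image (fun g => ∑ i, d (g i))).card ≤
      ((Matrix.det (∑ l, ((X : ℝ[X]) ^ d l) • (S l).map C)).roots.toFinset.filter
        (fun t => 0 < t)).card + 1)
    {p q r : ℕ} (hp : p ∈ (Matrix.det (∑ l, ((X : ℝ[X]) ^ d l) • (S l).map C)).support)
    (hq : q ∈ (Matrix.det (∑ l, ((X : ℝ[X]) ^ d l) • (S l).map C)).support)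
    (hr : r ∈ (Matrix.det (∑ l, ((X : ℝ[X]) ^ d l) • (S l).map C)).support) (hpq : p < q) (hqr : q < r) :
    let P := Matrix.det (∑ l, ((X : ℝ[X]) ^ d l) • (S l).map C)
    (|P.coeff p| * ∏ u ∈ P.support.erase p, |(p : ℝ) - u|) ^ (r - q) *
        (|P.coeff r| * ∏ u ∈ P.support.erase r, |(r : ℝ) - u|) ^ (q - p)
      ≤ (|P.coeff q| * ∏ u ∈ P.support.erase q, |(q : ℝ) - u|) ^ (r - p) :=
  newton_cone_coeff _ ((Finset.card_le_card (support_det_pencil_subset_sumset d S)).trans hZ) hp hq hr hpq hqr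

/-- Under the same sharpness hypothesis (and `det F ≠ 0`), `det F` has FULL support: every element of the
`m`-fold sumset of `d` carries a non-zero coefficient (sparse Descartes: `Z₊ < #supp`, and `supp ⊆ sumset`).  At
`m = 2` on a Sidon support this says all `det S_i` and all mixed discriminants `D(S_i,S_j)` are non-zero. [folklore] -/
theorem support_det_pencil_eq_sumset_of_sharp {K m : ℕ} (d : Fin K → ℕ) (S : Fin K → Matrix (Fin m) (Fin m) ℝ)
    (hP : Matrix.det (∑ l, ((X : ℝ[X]) ^ d l) • (S l).map C) ≠ 0)
    (hZ : ((Finset.univ : Finset (Fin m → Fin K)).image (fun g => ∑ i, d (g i))).card ≤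
      ((Matrix.det (∑ l, ((X : ℝ[X]) ^ d l) • (S l).map C)).roots.toFinset.filter
        (fun t => 0 < t)).card + 1) :
    (Matrix.det (∑ l, ((X : ℝ[X]) ^ d l) • (S l).map C)).support
      = (Finset.univ : Finset (Fin m → Fin K)).image (fun g => ∑ i, d (g i)) := by
  refine Finset.eq_of_subset_of_card_le (support_det_pencil_subset_sumset d S) ?_
  have h := Literature.Computability.AlgebraicComplexity.card_roots_toFinset_filter_pos_lt_card_support hP
  omega

end Summit.ValiantsHypothesis.ValiantsHypothesis.Theorems.LacunarySymmetroidMatrixDescartes.Census
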